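import Mathlib
import HarnessLib
import Summits.Langlands.Langlands.Theses.StickelbergerDial
import Literature.NumberTheory.GaloisRepresentations.ArtinRestriction
import Literature.NumberTheory.Automorphic.Sweep1Proofs
import Literature.NumberTheory.GaloisRepresentations.ToLocalRestrictField
import Literature.NumberTheory.GaloisRepresentations.ResidualRepRestrict
import Literature.NumberTheory.GaloisRepresentations.RestrictFieldSelf
import Summits.Langlands.Langlands.Theorems.StickelbergerDialUnramifiedFermatWitnessStubResidualBundleRestrictField

/-!
# Skeleton for crux stmt-Langlands-18025
`Summit.Langlands.Langlands.Theses.StickelbergerDial.UnramifiedFermatWitness` — line `Sketch`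

Route `route-Langlands-StickelbergerDial` (rev 4; `closes (hW : UnramifiedFermatWitness)
(hF : FLLiftingWeightZero) (hJ : SectorComplement) : Langlands`; this crux is `hW`, rank 2, "THE DOOR").
THE CRUX: for `K` CM, `K^{av}/K` finite, `n ≥ 2`, `ℓ > n²` unramified in `K`, `r : Γ_K → GL_n(ℚ̄_ℓ)` a.e.
unramified, crystalline of labelled Hodge–Tate weights `{0,…,n-1}` at every `v ∣ ℓ` (for THE pinned Fontaine
datum `fontainePstAdicCompletion v ℓ hv`), with a residual representation `τ` that is absolutely irreducible,
decomposed generic, absolutely irreducible with enormous image on `Γ_{K(ζ_ℓ)}` and scalar somewhere off it, there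
are a finite Galois CM `K'/K` linearly disjoint from `K^{av}` WITH `ℓ` UNRAMIFIED IN `K'`, and over `K'`: the
transported analytic hypotheses for `r|_{Γ_{K'}}`, a residual representation `τ'` of `r|_{Γ_{K'}}` with the same
four residual properties, and a WITNESS — a weight-`0` cuspidal `π` of `GL_n(𝔸_{K'})` unramified above `ℓ` and a
framed `r₀` with the Harris–Lan–Taylor–Thorne property of `r_ι(π)` whose residual representation is `τ'`.

## RESHAPE (lead c1, 2026-08-17): the `K' = K` composition — crux closed modulo ONE stub

Restriction along the identity `K ≤ K` is an INNER automorphism of `Γ_K` (the tree's `absGaloisRestrict K K`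
compares the chosen embedding `K̄ → K̄` with `id`, `absGaloisRestrict_isConj_of_algHom_holds`), so
`r.restrictField K = r(σ₀) r r(σ₀)⁻¹` is a change of frame (`FramedGaloisRep.exists_restrictField_self_eq_conj`, Literature `RestrictFieldSelf`, landed p162150).
Hence for `K' := K` (identity `K`-algebra structure) and `τ' := τ` EVERY transported clause of the conclusion is a
hypothesis of the crux up to a frame change: a.e. unramifiedness (§0), crystallinity + labelled weights at `w ∣ ℓ`
for THE SAME pinned datum `fontainePstAdicCompletion w ℓ hw`
(`FramedGaloisRep.isCrystallineFramed_and_labelledHodgeTateWeightsAt_restrictField_self`, frame invariance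
`isCrystallineFramed_conj_iff` / `labelledHodgeTateWeights_conj_eq`), the residual representation
(`FramedGaloisRep.isResidualRepOf_restrictField_self`: integral models are conjugation-stable), and the four
residual-image clauses + decomposed genericity verbatim (`H' = H`); the field-theoretic side conditions hold
(`IsGalois.self`, `Kav ⊗_K K ≅ Kav` a field, `ℓ` unramified in `K` by hypothesis).  What is left is ONE stub:

* `stub_residualAutomorphy_weightZero` (S0, XL — Serre-type, said openly): under the crux's hypotheses, `τ` is
  residually automorphic OVER `K` ITSELF in weight `0` and level prime to `ℓ` (a weight-`0` cuspidal `π` of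
  `GL_n(𝔸_K)` unramified above `ℓ` and a framed `r₀` with the HLTT property of `r_ι(π)` reducing to `τ`).  This is
  the weight part of the generalised Serre conjecture over the CM field `K` in the Fontaine–Laffaille range — the
  statement the Disproof's verdict box names as the crux's mathematical content — and no potential-automorphy /
  Moret-Bailly / pin-coherence machinery is needed to pass from it to the crux:
  `UnramifiedFermatWitness_of : S0 → UnramifiedFermatWitness` (kernel-checked).  NO pin coherence: S3a/S3b and the
  definition item `defn-FontainePstWeilDeligneData` are NOT on this path (correcting §3 of the previous lead's
  NOTES: the crux as filed is not formally blocked on D2; only its `K' ≠ K` instances are).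

The previous composition is kept as the ALTERNATIVE path `UnramifiedFermatWitness_of_potential : S1 → S3a → S3b →
UnramifiedFermatWitness` (the card's potential mechanism; S1 allows `K' ≠ K` but then needs the two local
base-change stubs), so the crux closes as soon as EITHER `{S0}` or `{S1, S3a, S3b}` closes.  Registered stubs:
S0, S1, S3a, S3b (S2 landed p159413).

The original line (card `Ideas/lambda-switch-laundering.md`, ideator k2; its `Sketch.lean` evidence file is not
readable from a prover jail and is, by its note, a first-lemma sketch, so the skeleton was reconstructed from the
card by the previous lead) cuts the crux along the three seams that separate its ARITHMETIC content from bookkeeping: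

* `stub_launderedResidualAutomorphy` (S1, XL — THE CORE, said openly): under the crux's hypotheses and for ANY
  two finite extensions `K^{av}`, `L` of `K` to avoid, there is a finite Galois CM `K'/K`, linearly disjoint from
  both, with `ℓ` unramified in `K'`, over which `τ' := τ ∘ res_{K'/K}` is decomposed generic and RESIDUALLY
  AUTOMORPHIC OF WEIGHT ZERO AND LEVEL PRIME TO `ℓ`: a weight-`0` cuspidal `π` unramified above `ℓ` and a framed
  `r₀` with the HLTT property of `r_ι(π)` and residual representation `τ'`.  On paper (the card): potential
  automorphy of `r` over a CM `K''` possibly RAMIFIED at `ℓ` (Matsumoto arXiv:2312.01551 Thm 5.16; Boxer–Calegari–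
  Gee–Newton–Thorne arXiv:2309.15880 Thm 3.2.1 + the Fontaine–Laffaille component calculus), Brauer + solvable
  descent putting `r` in a weakly compatible system `{R_λ}` over `K` (BLGGT Thm 5.4.1 port), a prime switch to
  `λ' ∤ ℓ` at which `R_{λ'}` is unramified above `ℓ` (the card's open sub-step "InertiaDetect"), and a SECOND
  Moret-Bailly run for `R_{λ'}` with `K'_w/K_v` prescribed unramified at `w ∣ ℓ` (BLGGT Prop 3.1.1), decomposed
  genericity of `τ'` being arranged by a split condition at an auxiliary prime.  None of these engines is in the
  tree (no étale cohomology of Dwork families, no Moret-Bailly, no compatible system attached to a cuspidal `π`,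
  no BCGNT/Matsumoto/BLGGT named facts); the stub is the crux's entire arithmetic content.
* `stub_residualBundle_restrictField` (S2, L, provable now — pure Galois bookkeeping): there is a finite "control"
  extension `L/K` (e.g. `K̄^{ker τ}(ζ_ℓ)`) such that for every number field `K' ⊇ K` linearly disjoint from `L`
  (`L ⊗_K K'` a field) the residual bundle transports to `τ' := τ ∘ res_{K'/K}`: `τ'` is a residual
  representation of `r|_{Γ_{K'}}`, absolutely irreducible, absolutely irreducible on `Γ_{K'(ζ_ℓ)}` with the SAME
  (enormous) image subgroup, and scalar at some `σ' ∉ Γ_{K'(ζ_ℓ)}` (linear disjointness makes `res(Γ_{K'})`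
  surject onto `Gal(L/K)`, so all image groups are unchanged).
* S2 LANDED (2026-08-17, p159413): `Summit.Langlands.Langlands.Theorems.UnramifiedFermatWitness.
  stub_residualBundle_restrictField`; the skeleton's `stub_residualBundle_restrictField` is now that theorem.
* `stub_crystallineBaseChange_local` (S3a) and `stub_labelledWeightsBaseChange_local` (S3b) — the PIN-COHERENCE
  RESIDUE, said openly, in its two LOCAL halves (reshaped from the first skeleton's global stub
  `stub_crystallineTransport_restrictField` after the stub worker's verdict `stub-blocked:
  defn-FontainePstWeilDeligneData`): along a continuous embedding `K → L` of `ℓ`-adic local fields, crystallinity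
  for `fontainePst K ℓ hK` passes to `ρ ∘ res` for `fontainePst L ℓ hL` (S3a), and "every labelled Hodge–Tate
  weight multiset equals `S`" does too (S3b).  True of the genuine `B_dR/D_pst` (Fontaine Exp. III §5.1, VIII
  §2.3.7; Brinon–Conrad Prop. 6.3.8), but the two data are INDEPENDENTLY ε-pinned (`FontaineDpst.fontainePst`):
  the period ring is the construction `B_dR` (so S3b is provable in principle, like the accepted named fact
  `Literature.NumberTheory.PAdicHodge.DeRhamBaseChange`, after a `B_dR` functoriality not yet formalised), while
  the Weil–Deligne half is specified only for locally unramified representations (clause (F8)), so S3a is formally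
  unreachable until definition item `defn-FontainePstWeilDeligneData` (D2) lands.  The GLOBAL transport along
  `res_{K'/K}` for the completions' data is PROVED here from S3a+S3b (`crystallineTransport_restrictField_of_local`,
  via the accepted plumbing `isCrystallineFramed_and_labelledHodgeTateWeightsAt_restrictField`); for `K' = K` it
  would be a change of frame (`absGaloisRestrict K K` is inner; `isCrystallineFramed_conj_iff`,
  `labelledHodgeTateWeights_conj_eq`), useless for the witness.
* `eventually_isUnramifiedAt_restrictField'` — NOT a stub: a.e.-unramifiedness restricts (proved here from
  `FramedGaloisRep.isUnramifiedAt_restrictField` and `tendsto_under_cofinite`).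
* `UnramifiedFermatWitness_of_potential : S1 → S3a → S3b → UnramifiedFermatWitness` — kernel-checked, no `sorry`:
  control field from the landed S2, the field `K'` and the witness from S1 (avoiding `K^{av}` and `L`), the
  residual bundle from S2, the analytic clauses from the lemma and S3a+S3b.  All stubs are load-bearing.

Disproof used (cdisprove cycle 1, `Cruxes/UnramifiedFermatWitness/Disproof.lean`, sorry-free, NO KILL): no
`_false_without_` lemma and no `-- Targets` section exist (no instance of the hypothesis bundle is constructible in
the tree); §1 verdict box ("MATHEMATICALLY the crux is a consequence of the generalised Serre conjecture … over `K`
ITSELF, `K' = K`") is exactly stub S0 and the `K' = K` composition; §4.1 (pin coherence across `restrictField`) is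
what that composition evades; §2 (Fermat-point witnesses are locally conjugation-dual above `ℓ`) restricts the
ROUTE's dial mechanism, not this skeleton (no stub realises `r̄` at a CM fibre); §1 `2 * n < ℓ` decorative — S0 omits
it.  Also honoured: refuter birth attacks (conclusion not junk-satisfiable: `CuspidalAutomorphicRepData` needs cusp
forms, `HasSatakeParamAt`/`IsUnramifiedAt` an eigenform in `W ∖ W'` — so S0 has no cheap proof either);
REVIEW-StickelbergerDial.md (Matsumoto 5.16 gives every conjunct but `ℓ` unramified in `K'`) = the ramified input of
S1; WildReachBarrier.md / WildClassDigitBudget.md concern born-unramified family witnesses (inside S1 only).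
`ledger negatives --problem Langlands`: no stub restates a typed refutation.
-/

set_option linter.dupNamespace false

noncomputable section

namespace Summit.Langlands.Langlands.Cruxes.UnramifiedFermatWitness.Sketch

open Summit.Langlands.Langlands.Theses.StickelbergerDial
open Filter IsDedekindDomain NumberField
open scoped TensorProduct

/-! ## 0. Almost-everywhere unramifiedness restricts (proved, not a stub) -/

/-- **A.e. unramifiedness restricts to `Γ_{K'}`**: if `ρ` is unramified at all but finitely many places of
`K`, then `ρ|_{Γ_{K'}} = ρ ∘ absGaloisRestrict K K'` is unramified at all but finitely many places of the number
field `K'` (inertia at `𝔔 ∣ w` restricts into inertia at `𝔔 ∩ \bar ℤ_K ∣ w ∩ 𝓞 K`,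
`FramedGaloisRep.isUnramifiedAt_restrictField`; `w ↦ w ∩ 𝓞 K` has finite fibres, `tendsto_under_cofinite`).
[cite: SerreAbelianLadic1968, Ch. I §2.1] -/
theorem eventually_isUnramifiedAt_restrictField' {K : Type} [Field K] [NumberField K] (K' : Type)
    [Field K'] [NumberField K'] [Algebra K K'] {A : Type*} [CommRing A] [TopologicalSpace A] {n : ℕ}
    (ρ : Literature.NumberTheory.GaloisRepresentations.FramedGaloisRep K A n)
    (h : ∀ᶠ v : HeightOneSpectrum (𝓞 K) in cofinite, ρ.IsUnramifiedAt v) :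
    ∀ᶠ w : HeightOneSpectrum (𝓞 K') in cofinite, (ρ.restrictField K').IsUnramifiedAt w := by
  filter_upwards [(Literature.NumberTheory.Automorphic.tendsto_under_cofinite (𝓞 K)).eventually h]
    with w hw
  exact ρ.isUnramifiedAt_restrictField (v := w.under (𝓞 K)) rfl hw

/-! ## 1. The three stubs -/

/-- **STUB S1 — ℓ-UNRAMIFIED POTENTIAL RESIDUAL AUTOMORPHY IN WEIGHT ZERO, avoiding two prescribed
finite extensions** (THE CORE of the crux; line `Sketch` = card `lambda-switch-laundering`).  Under the
crux's hypotheses on `(K, K^{av}, n, ℓ, ι, r, τ)` and for every further finite extension `L/K` to avoid,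
there are a number field `K'`, Galois and CM over `K`, linearly disjoint from `K^{av}` and from `L` over `K`,
with `ℓ` unramified in `K'`, a compactness witness `hcpt'`, a cuspidal `π` of `GL_n(𝔸_{K'})` and a framed
`r₀ : Γ_{K'} → GL_n(ℚ̄_ℓ)` such that, with `τ' := τ ∘ absGaloisRestrict K K'`: `τ'` is decomposed generic;
`π` has weight `0`; `r₀` has the Harris–Lan–Taylor–Thorne characterising property of `r_ι(π)` (for every
rational prime `q ≠ ℓ` above which `π` is unramified and every `v ∣ q`, `r₀` is unramified at `v` with the
Frobenius characteristic polynomial predicted by `π`'s Satake parameter); `τ'` is a residual representation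
of `r₀`; and `π` is unramified above `ℓ`.  Paper route (card): ramified potential automorphy of `r`
(Matsumoto 2023 Thm 5.16 / BCGNT Thm 3.2.1) → Brauer compatible system over `K` (BLGGT Thm 5.4.1 port) →
`λ'`-switch (InertiaDetect, open) → second Moret-Bailly run with `K'_w/K_v` unramified at `w ∣ ℓ` and a split
condition at a decomposed-generic prime (BLGGT Prop 3.1.1) → Chebotarev + Brauer–Nesbitt.  Not provable in the
tree today (no engine producing a cuspidal `π` over an `ℓ`-unramified field is formalised or vendored).
[cite: Qian2022, Thm. 1.4] [cite: BarnetlambEtAl2014, Prop. 3.1.1 and Thm. 5.4.1] [cite: ACCGHLNSTT2023, Thm. 6.1.1] -/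
theorem stub_launderedResidualAutomorphy :
    ∀ (K : Type) [Field K] [NumberField K], NumberField.IsCMField K →
    ∀ (Kav : Type) [Field Kav] [Algebra K Kav], FiniteDimensional K Kav →
    ∀ (n : ℕ), 2 ≤ n → ∀ (ℓ : ℕ) [Fact ℓ.Prime], n ^ 2 < ℓ → 2 * n < ℓ →
    Algebra.IsUnramifiedIn (NumberField.RingOfIntegers K) (Ideal.span {(ℓ : ℤ)}) →
    ∀ (ι : PadicAlgCl ℓ ≃+* ℂ)
      (r : Literature.NumberTheory.GaloisRepresentations.FramedGaloisRep K (PadicAlgCl ℓ) n)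
      (τ : Field.absoluteGaloisGroup K →* GL (Fin n) (Literature.NumberTheory.GaloisRepresentations.padicAlgClResidueField ℓ)),
    (∀ᶠ v in cofinite, r.IsUnramifiedAt v) →
    (∀ (v : IsDedekindDomain.HeightOneSpectrum (NumberField.RingOfIntegers K))
        (hv : (ℓ : NumberField.RingOfIntegers K) ∈ v.asIdeal),
      (Literature.NumberTheory.PAdicHodge.fontainePstAdicCompletion v ℓ hv).IsCrystallineFramed (r.toLocal v) ∧
        ∀ τ' : @AlgHom ℚ_[ℓ] (v.adicCompletion K) (PadicAlgCl ℓ) _ _ _ (Literature.NumberTheory.PAdicHodge.fontainePstAdicCompletion v ℓ hv).algebra _,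
          r.labelledHodgeTateWeightsAt v (Literature.NumberTheory.PAdicHodge.fontainePstAdicCompletion v ℓ hv).algebra (Literature.NumberTheory.PAdicHodge.fontainePstAdicCompletion v ℓ hv).𝔅
              (@AlgHom.toRingHom ℚ_[ℓ] (v.adicCompletion K) (PadicAlgCl ℓ) _ _ _ (Literature.NumberTheory.PAdicHodge.fontainePstAdicCompletion v ℓ hv).algebra _ τ') =
            (Multiset.range n).map fun i : ℕ => (i : ℤ)) →
    r.IsResidualRepOf (RingHom.id _) τ →
    Literature.NumberTheory.GaloisRepresentations.IsAbsIrreducible τ →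
    Literature.NumberTheory.GaloisRepresentations.IsDecomposedGeneric τ →
    Literature.NumberTheory.GaloisRepresentations.IsAbsIrreducible (τ.comp (Literature.NumberTheory.GaloisRepresentations.absGaloisGroupAdjoinRootsOfUnity K ℓ).subtype) →
    Literature.NumberTheory.GaloisRepresentations.Subgroup.IsEnormous ((Literature.NumberTheory.GaloisRepresentations.absGaloisGroupAdjoinRootsOfUnity K ℓ).map τ) →
    (∃ σ : Field.absoluteGaloisGroup K, σ ∉ (Literature.NumberTheory.GaloisRepresentations.absGaloisGroupAdjoinRootsOfUnity K ℓ) ∧ ∃ c : Literature.NumberTheory.GaloisRepresentations.padicAlgClResidueField ℓ, (τ σ).1 = c • 1) →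
    ∀ (L : Type) [Field L] [Algebra K L], FiniteDimensional K L →
    ∃ (K' : Type) (_ : Field K') (_ : NumberField K') (_ : Algebra K K'),
      IsGalois K K' ∧ NumberField.IsCMField K' ∧ IsField (TensorProduct K Kav K') ∧
      IsField (TensorProduct K L K') ∧
      Algebra.IsUnramifiedIn (NumberField.RingOfIntegers K') (Ideal.span {(ℓ : ℤ)}) ∧
      ∃ (hcpt' : Literature.NumberTheory.Automorphic.isCompact_glFiniteIntegralLevel n K')
        (π : Literature.NumberTheory.Automorphic.CuspidalAutomorphicRepData n K' hcpt')
        (r₀ : Literature.NumberTheory.GaloisRepresentations.FramedGaloisRep K' (PadicAlgCl ℓ) n),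
        Literature.NumberTheory.GaloisRepresentations.IsDecomposedGeneric (τ.comp (Literature.NumberTheory.GaloisRepresentations.absGaloisRestrict K K').toMonoidHom) ∧
        π.1.HasWeightZero ∧
        (∀ q : ℕ, q.Prime → q ≠ ℓ →
          (∀ w : IsDedekindDomain.HeightOneSpectrum (NumberField.RingOfIntegers K'),
            (q : NumberField.RingOfIntegers K') ∈ w.asIdeal → π.1.IsUnramifiedAt w) →
          ∀ v : IsDedekindDomain.HeightOneSpectrum (NumberField.RingOfIntegers K'),
            (q : NumberField.RingOfIntegers K') ∈ v.asIdeal → ∀ α : Multiset ℂ,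
              π.1.HasSatakeParamAt v α →
                r₀.IsUnramifiedAt v ∧ r₀.HasFrobCharpolyAt v
                  (Literature.NumberTheory.Automorphic.arithFrobPolyOfSatake ι v.residueCard n α)) ∧
        r₀.IsResidualRepOf (RingHom.id _) (τ.comp (Literature.NumberTheory.GaloisRepresentations.absGaloisRestrict K K').toMonoidHom) ∧
        ∀ w : IsDedekindDomain.HeightOneSpectrum (NumberField.RingOfIntegers K'),
          (ℓ : NumberField.RingOfIntegers K') ∈ w.asIdeal → π.1.IsUnramifiedAt w := by
  sorry

/-- **STUB S2 — the residual bundle transports along `res_{K'/K}` for `K'` linearly disjoint from a control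
field** (Galois bookkeeping, provable now).  Let `K` be a number field, `r : Γ_K → GL_n(ℚ̄_ℓ)` framed and
`τ : Γ_K → GL_n(ℤ̄_ℓ/𝔪)` a residual representation of `r` that is absolutely irreducible, absolutely irreducible
on `H = Γ_{K(ζ_ℓ)}` with `τ(H)` enormous, and scalar at some `σ ∉ H`.  Then there is a finite extension
`L/K` (witness: the fixed field of `ker τ` with `ζ_ℓ` adjoined, or its Galois closure) such that for every
number field `K' ⊇ K` with `L ⊗_K K'` a field (linear disjointness) and `τ' := τ ∘ absGaloisRestrict K K'`,
`H' = Γ_{K'(ζ_ℓ)}`: `τ'` is a residual representation of `r|_{Γ_{K'}} = r ∘ absGaloisRestrict K K'`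
(reduction and semisimplification compose with `res`; semisimplicity survives because the image group is
unchanged), `τ'` is absolutely irreducible and so is `τ'|_{H'}`, `τ'(H') = τ(H)` is enormous (the same subgroup
of `GL_n`), and `τ'(σ')` is scalar for some `σ' ∉ H'` — all because `res(Γ_{K'})` surjects onto `Gal(L/K)`
(Mathlib `IntermediateField.LinearDisjoint.of_isField`, `index_range_absGaloisRestrict_eq_finrank`) while
`res(H') = res(Γ_{K'}) ∩ H` (`mem_absGaloisGroupAdjoinRootsOfUnity_iff`, `absGaloisRestrict_apply_smul`).
Folklore (used tacitly with every "`F'` linearly disjoint from `F^{avoid}`" clause, e.g. BLGGT §4.5, ACC+ §6.1,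
Qian Thm 1.4). [cite: BarnetlambEtAl2014, §4.5 (role of F^{avoid})] -/
theorem stub_residualBundle_restrictField :
    ∀ (K : Type) [Field K] [NumberField K] (n : ℕ) (ℓ : ℕ) [Fact ℓ.Prime]
      (r : Literature.NumberTheory.GaloisRepresentations.FramedGaloisRep K (PadicAlgCl ℓ) n)
      (τ : Field.absoluteGaloisGroup K →* GL (Fin n) (Literature.NumberTheory.GaloisRepresentations.padicAlgClResidueField ℓ)),
    r.IsResidualRepOf (RingHom.id _) τ →
    Literature.NumberTheory.GaloisRepresentations.IsAbsIrreducible τ →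
    Literature.NumberTheory.GaloisRepresentations.IsAbsIrreducible (τ.comp (Literature.NumberTheory.GaloisRepresentations.absGaloisGroupAdjoinRootsOfUnity K ℓ).subtype) →
    Literature.NumberTheory.GaloisRepresentations.Subgroup.IsEnormous ((Literature.NumberTheory.GaloisRepresentations.absGaloisGroupAdjoinRootsOfUnity K ℓ).map τ) →
    (∃ σ : Field.absoluteGaloisGroup K, σ ∉ (Literature.NumberTheory.GaloisRepresentations.absGaloisGroupAdjoinRootsOfUnity K ℓ) ∧ ∃ c : Literature.NumberTheory.GaloisRepresentations.padicAlgClResidueField ℓ, (τ σ).1 = c • 1) →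
    ∃ (L : Type) (_ : Field L) (_ : Algebra K L), FiniteDimensional K L ∧
      ∀ (K' : Type) [Field K'] [NumberField K'] [Algebra K K'], IsField (TensorProduct K L K') →
        (r.restrictField K').IsResidualRepOf (RingHom.id _) (τ.comp (Literature.NumberTheory.GaloisRepresentations.absGaloisRestrict K K').toMonoidHom) ∧
        Literature.NumberTheory.GaloisRepresentations.IsAbsIrreducible (τ.comp (Literature.NumberTheory.GaloisRepresentations.absGaloisRestrict K K').toMonoidHom) ∧
        Literature.NumberTheory.GaloisRepresentations.IsAbsIrreducible ((τ.comp (Literature.NumberTheory.GaloisRepresentations.absGaloisRestrict K K').toMonoidHom).comp (Literature.NumberTheory.GaloisRepresentations.absGaloisGroupAdjoinRootsOfUnity K' ℓ).subtype) ∧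
        Literature.NumberTheory.GaloisRepresentations.Subgroup.IsEnormous ((Literature.NumberTheory.GaloisRepresentations.absGaloisGroupAdjoinRootsOfUnity K' ℓ).map (τ.comp (Literature.NumberTheory.GaloisRepresentations.absGaloisRestrict K K').toMonoidHom)) ∧
        ∃ σ : Field.absoluteGaloisGroup K', σ ∉ (Literature.NumberTheory.GaloisRepresentations.absGaloisGroupAdjoinRootsOfUnity K' ℓ) ∧
          ∃ c : Literature.NumberTheory.GaloisRepresentations.padicAlgClResidueField ℓ, ((τ.comp (Literature.NumberTheory.GaloisRepresentations.absGaloisRestrict K K').toMonoidHom) σ).1 = c • 1 :=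
  Summit.Langlands.Langlands.Theorems.UnramifiedFermatWitness.stub_residualBundle_restrictField

/-- **STUB S3a — crystallinity for THE pinned Fontaine data is insensitive to a finite extension of
the `ℓ`-adic base field** (LOCAL base change, the Weil–Deligne half of the pin-coherence residue).  For a
continuous embedding `K → L` of characteristic-`0` non-archimedean local fields of residue characteristic `ℓ`
(`hK : |ℓ|_K < 1`, `hL : |ℓ|_L < 1`) and a framed `ρ : Γ_K →ₜ* GL_n(ℚ̄_ℓ)` crystalline for `fontainePst K ℓ hK`,
the restriction `ρ ∘ absGaloisRestrict K L` is crystalline for `fontainePst L ℓ hL`.  TRUE for Fontaine's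
genuine `(B_dR, D_pst)`: `B_cris`- (equivalently: de Rham + `WD` unramified with `N = 0`) admissibility commutes
with finite base change (Fontaine 1994, Exp. III §5.1, Exp. VIII §2.3.7; Brinon–Conrad Prop. 6.3.8 for the de
Rham part, whose tree form is the accepted named fact `Literature.NumberTheory.PAdicHodge.DeRhamBaseChange`).
For THE tree's data it is not provable today: the Weil–Deligne half of `fontainePst` is chosen by Hilbert's ε
INDEPENDENTLY at `K` and at `L` and constrained only for locally unramified representations (clause (F8) of
`IsFontaineDatum`); it becomes a theorem when definition item `defn-FontainePstWeilDeligneData` (D2: `WD ∘ D_pst`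
constructed) lands.  Shape = hypothesis `hcr` of the accepted plumbing
`isCrystallineFramed_and_labelledHodgeTateWeightsAt_restrictField` (`ToLocalRestrictField`), quantified over `ℓ`.
STATUS (2026-08-17): this signature is VERBATIM the accepted unproved named fact
`Literature.NumberTheory.PAdicHodge.CrystallineBaseChange` (file `Literature/NumberTheory/PAdicHodge/
CrystallineBaseChange.lean`); the stub closes by `exact CrystallineBaseChange_holds …` the day that fact is
discharged (blocked on definition item `defn-FontainePstWeilDeligneData`).
[cite: FontaineAsterisque223VIII, §2.3.7] [cite: FontaineAsterisque223III, Exp. III §5.1]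
[cite: BrinonConrad2009, Prop. 6.3.8] -/
theorem stub_crystallineBaseChange_local :
    ∀ (ℓ : ℕ) [Fact ℓ.Prime] (K L : Type) [Field K] [ValuativeRel K] [TopologicalSpace K]
      [IsNonarchimedeanLocalField K] [CharZero K] [Field L] [ValuativeRel L] [TopologicalSpace L]
      [IsNonarchimedeanLocalField L] [CharZero L] [Algebra K L], Continuous (algebraMap K L) →
      ∀ (hK : ValuativeRel.valuation K (ℓ : K) < 1) (hL : ValuativeRel.valuation L (ℓ : L) < 1) (n : ℕ)
        (ρ : Literature.NumberTheory.GaloisRepresentations.FramedRep (Field.absoluteGaloisGroup K) (PadicAlgCl ℓ) n),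
        (Literature.NumberTheory.PAdicHodge.fontainePst K ℓ hK).IsCrystallineFramed ρ →
          (Literature.NumberTheory.PAdicHodge.fontainePst L ℓ hL).IsCrystallineFramed
            (ρ.comp (Literature.NumberTheory.GaloisRepresentations.absGaloisRestrict K L)) := by
  sorry

/-- **STUB S3b — the labelled Hodge–Tate weights for THE pinned Fontaine data are insensitive to a finite
extension of the `ℓ`-adic base field** (LOCAL base change, the `B_dR` half of the pin-coherence residue).
For a continuous embedding `K → L` of characteristic-`0` non-archimedean local fields of residue characteristic
`ℓ`, a framed `ρ : Γ_K →ₜ* GL_n(ℚ̄_ℓ)` and a multiset `S`: if `HT_{τ'}(ρ) = S` for every `ℚ_ℓ`-embedding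
`τ' : K → ℚ̄_ℓ` (weights relative to `(fontainePst K ℓ hK).𝔅 = B_dR(K)`), then `HT_{τ''}(ρ ∘ res_{L/K}) = S`
for every `τ'' : L → ℚ̄_ℓ` (relative to `B_dR(L)`).  TRUE for Fontaine's `B_dR`: `L ⊗_K D_{dR,K}(V) ≅
D_{dR,L}(V)` in `Fil_L` (Brinon–Conrad Prop. 6.3.8), so `HT_{τ''}(V|_{Γ_L}) = HT_{τ''|_K}(V)`.  For THE
tree's data the period rings ARE the constructions `bdRPeriodRingData` (clause (F9), unconditionally), so this
is provable in principle — by transporting the tree's `B_dR(L)` to `B_dR(K)` along `\widehat{K̄} ≅ \widehat{L̄}`,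
the same missing functoriality that keeps `DeRhamBaseChange` a named fact — but not today.  Shape =
hypothesis `hHT` of `isCrystallineFramed_and_labelledHodgeTateWeightsAt_restrictField`, quantified over `ℓ`,
with the datum's `ℚ_ℓ`-structure passed explicitly.
STATUS (2026-08-17, wave-1 stub worker): this signature is VERBATIM the accepted unproved named fact
`Literature.NumberTheory.PAdicHodge.LabelledHodgeTateWeightsBaseChange` (same file as `CrystallineBaseChange`);
`stub-blocked` on it.  Missing ingredients, measured: (M1) NO cross-field map exists at any layer of the tree's
`B_dR` tower (`integerC → BDeRhamPlus → FracBdR → fil`, all `variable {F}` with `σ : Γ_F` only; generic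
functoriality exists only for the tilt/θ layer, `FontaineThetaNaturality`): needed is a `Γ_L`-equivariant filtered
ring isomorphism `(bdRPeriodRingData hK).B ≃+* (bdRPeriodRingData hL).B` over `K → L` along `absClosureEmbedding K L`
(≈ 1500–2500 lines: spectral-norm uniqueness `‖absClosureEmbedding K L x‖ = ‖x‖`, completion, then rerunning the
`σ`-proofs for the iso); (M2) an abstract `PeriodRingData`-level base change of `labelFilD` (transport along the iso,
Galois descent via Speiser `span_fixedPoints_eq_top` + Ax–Sen–Tate for a Galois closure, label splitting
`L ⊗_K D_{τ'} ≅ ⊕_{τ''|K = τ'} D_{τ''}`; ≈ 800–1200 lines).  TRUE as stated (also for non-de Rham `ρ`).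
[cite: BrinonConrad2009, Prop. 6.3.8] [cite: FontaineAsterisque223III, Exp. III §1.5 and §3] -/
theorem stub_labelledWeightsBaseChange_local :
    ∀ (ℓ : ℕ) [Fact ℓ.Prime] (K L : Type) [Field K] [ValuativeRel K] [TopologicalSpace K]
      [IsNonarchimedeanLocalField K] [CharZero K] [Field L] [ValuativeRel L] [TopologicalSpace L]
      [IsNonarchimedeanLocalField L] [CharZero L] [Algebra K L], Continuous (algebraMap K L) →
      ∀ (hK : ValuativeRel.valuation K (ℓ : K) < 1) (hL : ValuativeRel.valuation L (ℓ : L) < 1) (n : ℕ)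
        (ρ : Literature.NumberTheory.GaloisRepresentations.FramedRep (Field.absoluteGaloisGroup K) (PadicAlgCl ℓ) n) (S : Multiset ℤ),
        (∀ τ' : @AlgHom ℚ_[ℓ] K (PadicAlgCl ℓ) _ _ _ (Literature.NumberTheory.PAdicHodge.fontainePst K ℓ hK).algebra _,
          @Literature.NumberTheory.GaloisRepresentations.PeriodRingData.labelledHodgeTateWeights _ _ _ ℚ_[ℓ] K _ _
            (Literature.NumberTheory.PAdicHodge.fontainePst K ℓ hK).algebra (PadicAlgCl ℓ) _ _ _ _ _ _ _ _ _
            (Literature.NumberTheory.PAdicHodge.fontainePst K ℓ hK).𝔅 (Literature.NumberTheory.GaloisRepresentations.FramedRep.toContinuousRep ρ)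
            (@AlgHom.toRingHom ℚ_[ℓ] K (PadicAlgCl ℓ) _ _ _ (Literature.NumberTheory.PAdicHodge.fontainePst K ℓ hK).algebra _ τ') = S) →
        ∀ τ'' : @AlgHom ℚ_[ℓ] L (PadicAlgCl ℓ) _ _ _ (Literature.NumberTheory.PAdicHodge.fontainePst L ℓ hL).algebra _,
          @Literature.NumberTheory.GaloisRepresentations.PeriodRingData.labelledHodgeTateWeights _ _ _ ℚ_[ℓ] L _ _
            (Literature.NumberTheory.PAdicHodge.fontainePst L ℓ hL).algebra (PadicAlgCl ℓ) _ _ _ _ _ _ _ _ _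
            (Literature.NumberTheory.PAdicHodge.fontainePst L ℓ hL).𝔅 (Literature.NumberTheory.GaloisRepresentations.FramedRep.toContinuousRep (ρ.comp (Literature.NumberTheory.GaloisRepresentations.absGaloisRestrict K L)))
            (@AlgHom.toRingHom ℚ_[ℓ] L (PadicAlgCl ℓ) _ _ _ (Literature.NumberTheory.PAdicHodge.fontainePst L ℓ hL).algebra _ τ'') = S := by
  sorry

/-- **S3 (global) from S3a + S3b** — crystalline-ness and labelled Hodge–Tate weights `{0,…,n-1}` transport
along `res_{K'/K}` for THE pinned Fontaine data of the completions: the number-field plumbing is the accepted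
`isCrystallineFramed_and_labelledHodgeTateWeightsAt_restrictField` (`ToLocalRestrictField`: the two routes
`Γ_{K'_w} → Γ_K` are conjugate, `exists_toLocal_restrictField_eq_conj`, and both clauses are frame-invariant),
fed with the two LOCAL stubs.  (This was the registered stub `stub_crystallineTransport_restrictField` of the
first skeleton; reshaped 2026-08-17 after the stub worker's verdict `stub-blocked: defn-FontainePstWeilDeligneData`
into its two local halves, which are exactly the statements a Literature seat can vendor.)
[cite: ACCGHLNSTT2023, §6.5.12 (proof of Thm. 6.1.1, p. 89)] [cite: BrinonConrad2009, Prop. 6.3.8] -/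
theorem crystallineTransport_restrictField_of_local (hcr : type_of% @stub_crystallineBaseChange_local)
    (hHT : type_of% @stub_labelledWeightsBaseChange_local) :
    ∀ (K : Type) [Field K] [NumberField K] (K' : Type) [Field K'] [NumberField K'] [Algebra K K']
      (ℓ : ℕ) [Fact ℓ.Prime] (n : ℕ)
      (r : Literature.NumberTheory.GaloisRepresentations.FramedGaloisRep K (PadicAlgCl ℓ) n),
    (∀ (v : IsDedekindDomain.HeightOneSpectrum (NumberField.RingOfIntegers K))
        (hv : (ℓ : NumberField.RingOfIntegers K) ∈ v.asIdeal),
      (Literature.NumberTheory.PAdicHodge.fontainePstAdicCompletion v ℓ hv).IsCrystallineFramed (r.toLocal v) ∧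
        ∀ τ' : @AlgHom ℚ_[ℓ] (v.adicCompletion K) (PadicAlgCl ℓ) _ _ _ (Literature.NumberTheory.PAdicHodge.fontainePstAdicCompletion v ℓ hv).algebra _,
          r.labelledHodgeTateWeightsAt v (Literature.NumberTheory.PAdicHodge.fontainePstAdicCompletion v ℓ hv).algebra (Literature.NumberTheory.PAdicHodge.fontainePstAdicCompletion v ℓ hv).𝔅
              (@AlgHom.toRingHom ℚ_[ℓ] (v.adicCompletion K) (PadicAlgCl ℓ) _ _ _ (Literature.NumberTheory.PAdicHodge.fontainePstAdicCompletion v ℓ hv).algebra _ τ') =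
            (Multiset.range n).map fun i : ℕ => (i : ℤ)) →
    ∀ (w : IsDedekindDomain.HeightOneSpectrum (NumberField.RingOfIntegers K'))
      (hw : (ℓ : NumberField.RingOfIntegers K') ∈ w.asIdeal),
      (Literature.NumberTheory.PAdicHodge.fontainePstAdicCompletion w ℓ hw).IsCrystallineFramed ((r.restrictField K').toLocal w) ∧
        ∀ τ'' : @AlgHom ℚ_[ℓ] (w.adicCompletion K') (PadicAlgCl ℓ) _ _ _ (Literature.NumberTheory.PAdicHodge.fontainePstAdicCompletion w ℓ hw).algebra _,
          (r.restrictField K').labelledHodgeTateWeightsAt w (Literature.NumberTheory.PAdicHodge.fontainePstAdicCompletion w ℓ hw).algebra (Literature.NumberTheory.PAdicHodge.fontainePstAdicCompletion w ℓ hw).𝔅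
              (@AlgHom.toRingHom ℚ_[ℓ] (w.adicCompletion K') (PadicAlgCl ℓ) _ _ _ (Literature.NumberTheory.PAdicHodge.fontainePstAdicCompletion w ℓ hw).algebra _ τ'') =
            (Multiset.range n).map fun i : ℕ => (i : ℤ) := by
  intro K _ _ K' _ _ _ ℓ _ n r h w hw
  exact Literature.NumberTheory.GaloisRepresentations.isCrystallineFramed_and_labelledHodgeTateWeightsAt_restrictField (hcr ℓ) (hHT ℓ)
    r _ h w hw




/-! ## 1b. The `K' = K` stub (lead c1 reshape, 2026-08-17) -/

/-- **STUB S0 — RESIDUAL AUTOMORPHY OF `τ` OVER `K` ITSELF, IN WEIGHT ZERO AND LEVEL PRIME TO `ℓ`**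
(the `K' = K` instance of the crux; Serre-type).  Let `K` be a CM number field, `n ≥ 2`, `ℓ > n²` a
prime unramified in `K`, `ι : ℚ̄_ℓ ≃ ℂ`, `r : Γ_K → GL_n(ℚ̄_ℓ)` framed, a.e. unramified, crystalline with
labelled Hodge–Tate weights `{0,…,n-1}` at every `v ∣ ℓ` (for THE pinned datum
`fontainePstAdicCompletion v ℓ hv`), and `τ : Γ_K → GL_n(𝔽̄_ℓ)` a residual representation of `r` that
is absolutely irreducible, decomposed generic, absolutely irreducible with enormous image on
`Γ_{K(ζ_ℓ)}` and scalar at some `σ ∉ Γ_{K(ζ_ℓ)}`.  Then `τ` is RESIDUALLY AUTOMORPHIC OF WEIGHT `0` AND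
LEVEL PRIME TO `ℓ`: there are a compactness witness `hcpt`, a cuspidal automorphic representation `π`
of `GL_n(𝔸_K)` of weight `0`, unramified above `ℓ`, and a framed `r₀ : Γ_K → GL_n(ℚ̄_ℓ)` with the
Harris–Lan–Taylor–Thorne property of `r_ι(π)` (for every rational prime `q ≠ ℓ` above which `π` is
unramified and every `v ∣ q`, `r₀` is unramified at `v` with Frobenius characteristic polynomial
`arithFrobPolyOfSatake ι (N v) n α` for the Satake parameter `α` of `π_v`) whose residual
representation is `τ`.  STATUS: this is the weight part of the generalised Serre modularity
conjecture for `GL_n` over the CM field `K` in the Fontaine–Laffaille range (the crystalline lift `r`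
of weights `{0,…,n-1}` with `ℓ > n` unramified makes the trivial Serre weight a predicted weight of
`τ`; Ash–Doud–Pollack–Sinnott / Herzig / Gee–Herzig–Savitt conjectures), together with the existence
of the Galois representations attached to weight-`0` cuspidal `π` (Harris–Lan–Taylor–Thorne, Scholze);
no case with `τ(Γ_{K(ζ_ℓ)})` enormous is a theorem in print (known: `n = 2` over `ℚ`,
Khare–Wintenberger; Hecke characters).  It is the crux's entire arithmetic content once the field
extension `K'/K` is not used (Disproof §1, verdict box), and it IMPLIES the crux with `K' := K`
(`UnramifiedFermatWitness_of`, no pin coherence needed).  Registered so that the crux closes the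
moment residual automorphy over `K` is available from ANY source (e.g. a route that proves Serre-type
automorphy for the residual image at hand, or a conditional bridge filed by the planner).
[cite: ACCGHLNSTT2023, Thm. 6.1.1 (hypotheses) and §1] [cite: Clozel1990, §3.5 and Conj. 4.5] -/
theorem stub_residualAutomorphy_weightZero :
    ∀ (K : Type) [Field K] [NumberField K], NumberField.IsCMField K →
    ∀ (n : ℕ), 2 ≤ n → ∀ (ℓ : ℕ) [Fact ℓ.Prime], n ^ 2 < ℓ →
    Algebra.IsUnramifiedIn (NumberField.RingOfIntegers K) (Ideal.span {(ℓ : ℤ)}) →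
    ∀ (ι : PadicAlgCl ℓ ≃+* ℂ)
      (r : Literature.NumberTheory.GaloisRepresentations.FramedGaloisRep K (PadicAlgCl ℓ) n)
      (τ : Field.absoluteGaloisGroup K →* GL (Fin n) (Literature.NumberTheory.GaloisRepresentations.padicAlgClResidueField ℓ)),
    (∀ᶠ v in cofinite, r.IsUnramifiedAt v) →
    (∀ (v : IsDedekindDomain.HeightOneSpectrum (NumberField.RingOfIntegers K))
        (hv : (ℓ : NumberField.RingOfIntegers K) ∈ v.asIdeal),
      (Literature.NumberTheory.PAdicHodge.fontainePstAdicCompletion v ℓ hv).IsCrystallineFramed (r.toLocal v) ∧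
        ∀ τ' : @AlgHom ℚ_[ℓ] (v.adicCompletion K) (PadicAlgCl ℓ) _ _ _ (Literature.NumberTheory.PAdicHodge.fontainePstAdicCompletion v ℓ hv).algebra _,
          r.labelledHodgeTateWeightsAt v (Literature.NumberTheory.PAdicHodge.fontainePstAdicCompletion v ℓ hv).algebra (Literature.NumberTheory.PAdicHodge.fontainePstAdicCompletion v ℓ hv).𝔅
              (@AlgHom.toRingHom ℚ_[ℓ] (v.adicCompletion K) (PadicAlgCl ℓ) _ _ _ (Literature.NumberTheory.PAdicHodge.fontainePstAdicCompletion v ℓ hv).algebra _ τ') =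
            (Multiset.range n).map fun i : ℕ => (i : ℤ)) →
    r.IsResidualRepOf (RingHom.id _) τ →
    Literature.NumberTheory.GaloisRepresentations.IsAbsIrreducible τ →
    Literature.NumberTheory.GaloisRepresentations.IsDecomposedGeneric τ →
    Literature.NumberTheory.GaloisRepresentations.IsAbsIrreducible (τ.comp (Literature.NumberTheory.GaloisRepresentations.absGaloisGroupAdjoinRootsOfUnity K ℓ).subtype) →
    Literature.NumberTheory.GaloisRepresentations.Subgroup.IsEnormous ((Literature.NumberTheory.GaloisRepresentations.absGaloisGroupAdjoinRootsOfUnity K ℓ).map τ) →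
    (∃ σ : Field.absoluteGaloisGroup K, σ ∉ (Literature.NumberTheory.GaloisRepresentations.absGaloisGroupAdjoinRootsOfUnity K ℓ) ∧ ∃ c : Literature.NumberTheory.GaloisRepresentations.padicAlgClResidueField ℓ, (τ σ).1 = c • 1) →
    ∃ (hcpt : Literature.NumberTheory.Automorphic.isCompact_glFiniteIntegralLevel n K)
      (π : Literature.NumberTheory.Automorphic.CuspidalAutomorphicRepData n K hcpt)
      (r₀ : Literature.NumberTheory.GaloisRepresentations.FramedGaloisRep K (PadicAlgCl ℓ) n),
      π.1.HasWeightZero ∧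
      (∀ q : ℕ, q.Prime → q ≠ ℓ →
        (∀ w : IsDedekindDomain.HeightOneSpectrum (NumberField.RingOfIntegers K),
          (q : NumberField.RingOfIntegers K) ∈ w.asIdeal → π.1.IsUnramifiedAt w) →
        ∀ v : IsDedekindDomain.HeightOneSpectrum (NumberField.RingOfIntegers K),
          (q : NumberField.RingOfIntegers K) ∈ v.asIdeal → ∀ α : Multiset ℂ,
            π.1.HasSatakeParamAt v α →
              r₀.IsUnramifiedAt v ∧ r₀.HasFrobCharpolyAt v
                (Literature.NumberTheory.Automorphic.arithFrobPolyOfSatake ι v.residueCard n α)) ∧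
      r₀.IsResidualRepOf (RingHom.id _) τ ∧
      ∀ w : IsDedekindDomain.HeightOneSpectrum (NumberField.RingOfIntegers K),
        (ℓ : NumberField.RingOfIntegers K) ∈ w.asIdeal → π.1.IsUnramifiedAt w := by
  sorry

/-! ## 1c. Restriction along `K ≤ K` is a change of frame — LANDED (p162150, 2026-08-17):
`Literature/NumberTheory/GaloisRepresentations/RestrictFieldSelf.lean` (`exists_absGaloisRestrict_self_eq_conj`,
`FramedGaloisRep.exists_restrictField_self_eq_conj`, `FramedGaloisRep.isResidualRepOf_restrictField_self`,
`FramedGaloisRep.isCrystallineFramed_and_labelledHodgeTateWeightsAt_restrictField_self`,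
`IsIntegralModelOf/IsReductionOf/IsResidualRepOf.conj_comp`), imported above. -/

namespace SelfRestrict

/-- `Kav ⊗_K K` is a field (it is `Kav`, `Algebra.TensorProduct.rid`): the linear-disjointness side condition of
the crux for `K' := K`. [folklore] -/
theorem isField_tensorProduct_self (K Kav : Type) [Field K] [Field Kav] [Algebra K Kav] :
    IsField (TensorProduct K Kav K) :=
  (Algebra.TensorProduct.rid K K Kav).toMulEquiv.isField (Field.toIsField Kav)

end SelfRestrict

/-! ## 2. The stub statements as named propositions -/

namespace _Goal

/-- The statement of `stub_launderedResidualAutomorphy` (literally its type). [folklore] -/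
def stub_launderedResidualAutomorphy : Prop :=
  type_of% @Summit.Langlands.Langlands.Cruxes.UnramifiedFermatWitness.Sketch.stub_launderedResidualAutomorphy

/-- The statement of `stub_residualAutomorphy_weightZero` (literally its type). [folklore] -/
def stub_residualAutomorphy_weightZero : Prop :=
  type_of% @Summit.Langlands.Langlands.Cruxes.UnramifiedFermatWitness.Sketch.stub_residualAutomorphy_weightZero

/-- The statement of `stub_crystallineBaseChange_local` (literally its type). [folklore] -/
def stub_crystallineBaseChange_local : Prop :=
  type_of% @Summit.Langlands.Langlands.Cruxes.UnramifiedFermatWitness.Sketch.stub_crystallineBaseChange_local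

/-- The statement of `stub_labelledWeightsBaseChange_local` (literally its type). [folklore] -/
def stub_labelledWeightsBaseChange_local : Prop :=
  type_of% @Summit.Langlands.Langlands.Cruxes.UnramifiedFermatWitness.Sketch.stub_labelledWeightsBaseChange_local

end _Goal

/-! ## 3. The composition (kernel-checked, no `sorry`) -/

/-- **`UnramifiedFermatWitness` from the single stub S0 (`K' := K`).**  Take `K' := K` with its identity
`K`-algebra structure, `τ' := τ`, and `(hcpt', π, r₀)` from S0.  Then: `K/K` is Galois (`IsGalois.self`),
`K` is CM and `ℓ`-unramified by hypothesis, `Kav ⊗_K K` is a field (`isField_tensorProduct_self`);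
`r|_{Γ_K}` is a.e. unramified (`eventually_isUnramifiedAt_restrictField'`); since `r|_{Γ_K}` is the frame
change `r(σ₀) r r(σ₀)⁻¹` (`exists_restrictField_self_eq_conj`), it is crystalline of labelled weights
`{0,…,n-1}` at every `w ∣ ℓ` for THE SAME pinned datum
(`isCrystallineFramed_and_labelledHodgeTateWeightsAt_restrictField_self`) and has `τ` as a residual
representation (`isResidualRepOf_restrictField_self`); the four residual-image clauses and decomposed
genericity for `τ' = τ`, `H' = H` are the hypotheses verbatim; the witness clauses are S0's.  No pin
coherence (S3a/S3b), no control field (S2), no Chebotarev.  The conclusion is the route decl BY NAME.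
[folklore] -/
theorem UnramifiedFermatWitness_of (h₀ : _Goal.stub_residualAutomorphy_weightZero) :
    Summit.Langlands.Langlands.Theses.StickelbergerDial.UnramifiedFermatWitness := by
  unfold _Goal.stub_residualAutomorphy_weightZero at h₀
  intro K _ _ hK Kav _ _ hKav n hn ℓ _ hn2 h2n hunr k ι r τ hae hcris hres habs hdg H habsH hen hσ
  obtain ⟨hcpt', π, r₀, hwt, hcomp, hres₀, hunrπ⟩ :=
    h₀ K hK n hn ℓ hn2 hunr ι r τ hae hcris hres habs hdg habsH hen hσ
  exact ⟨K, inferInstance, inferInstance, Algebra.id K, IsGalois.self K, hK,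
    SelfRestrict.isField_tensorProduct_self K Kav, hunr, hcpt', τ, π, r₀,
    eventually_isUnramifiedAt_restrictField' K r hae,
    r.isCrystallineFramed_and_labelledHodgeTateWeightsAt_restrictField_self _ hcris,
    Literature.NumberTheory.GaloisRepresentations.FramedGaloisRep.isResidualRepOf_restrictField_self hres,
    habs, hdg, habsH, hen, hσ, hwt, hcomp, hres₀, hunrπ⟩

/-- By-name sanity check: the single stub feeds the primary composition as it stands. -/
example : Summit.Langlands.Langlands.Theses.StickelbergerDial.UnramifiedFermatWitness :=
  UnramifiedFermatWitness_of stub_residualAutomorphy_weightZero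


/-- **`UnramifiedFermatWitness` from the stubs.**  Given the crux's data and hypotheses: the LANDED S2
(`Summit.Langlands.Langlands.Theorems.UnramifiedFermatWitness.stub_residualBundle_restrictField`, p159413)
provides the control field `L`; S1 a finite Galois CM `K'/K`, linearly disjoint from `K^{av}` and from `L`,
with `ℓ` unramified in `K'`, together with `hcpt'`, the witness `(π, r₀)` and decomposed genericity of
`τ' := τ ∘ res_{K'/K}`; S2 again (fed the disjointness from `L`) the rest of the residual bundle for `τ'`;
the a.e. unramifiedness of `r|_{Γ_{K'}}` is `eventually_isUnramifiedAt_restrictField'`; the crystalline /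
labelled-weights clause at `w ∣ ℓ` is `crystallineTransport_restrictField_of_local` fed with the two LOCAL
stubs S3a, S3b.  The conclusion is the route decl BY NAME. [folklore] -/
theorem UnramifiedFermatWitness_of_potential (h₁ : _Goal.stub_launderedResidualAutomorphy)
    (h₃a : _Goal.stub_crystallineBaseChange_local) (h₃b : _Goal.stub_labelledWeightsBaseChange_local) :
    Summit.Langlands.Langlands.Theses.StickelbergerDial.UnramifiedFermatWitness := by
  unfold _Goal.stub_launderedResidualAutomorphy at h₁
  unfold _Goal.stub_crystallineBaseChange_local at h₃a
  unfold _Goal.stub_labelledWeightsBaseChange_local at h₃b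
  intro K _ _ hK Kav _ _ hKav n hn ℓ _ hn2 h2n hunr k ι r τ hae hcris hres habs hdg H habsH hen hσ
  -- S2 (landed): the control field of `τ`
  obtain ⟨L, iFL, iAL, hfdL, hL⟩ := stub_residualBundle_restrictField K n ℓ r τ hres habs habsH hen hσ
  -- S1: the ℓ-unramified field `K'` avoiding `Kav` and `L`, with the weight-zero witness
  obtain ⟨K', iF, iN, iA, hgal, hcm, hdisj, hdisjL, hunr', hcpt', π, r₀, hdg', hwt, hcomp, hres₀, hunrπ⟩ :=
    h₁ K hK Kav hKav n hn ℓ hn2 h2n hunr ι r τ hae hcris hres habs hdg habsH hen hσ L hfdL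
  -- S2 again: the residual bundle over `K'`
  obtain ⟨hres', habs', habsH', hen', hσ'⟩ := hL K' hdisjL
  refine ⟨K', iF, iN, iA, hgal, hcm, hdisj, hunr', hcpt', _, π, r₀,
    eventually_isUnramifiedAt_restrictField' K' r hae,
    crystallineTransport_restrictField_of_local h₃a h₃b K K' ℓ n r hcris, hres', habs', hdg', habsH',
    hen', hσ', hwt, hcomp, hres₀, hunrπ⟩

/-- By-name sanity check: the stubs feed the composition as they stand. -/
example : Summit.Langlands.Langlands.Theses.StickelbergerDial.UnramifiedFermatWitness :=
  UnramifiedFermatWitness_of_potential stub_launderedResidualAutomorphy stub_crystallineBaseChange_local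
    stub_labelledWeightsBaseChange_local

end Summit.Langlands.Langlands.Cruxes.UnramifiedFermatWitness.Sketch

end
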